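import Mathlib
import Summits.KontsevichZagierPeriods.Zeta5Search.CatalanQSumDiagonal
import Literature.NumberTheory.Irrationality.Zudilin2003.CatalanRemarks
import HarnessLib

/-!
# Catalan box family — Zudilin's SECOND recursion (2002, Theorem 2): `ũ_n` is the box value at `(n−1, n, n, n−1, n+1)`

HONEST FRAMING: systematic search; no irrationality claim unless certified.

Cell `pub-zeta5`, planner seat `fam-catalan` (gen 7); sequel to `CatalanQSumDiagonal` (gen 6: the diagonal `catalanQ(n,…,n) = 8(−1)ⁿuₙ`
with `uₙ` the solution of Zudilin's FIRST recursion, arXiv:math/0201024).  Here `ũ_n = Literature.NumberTheory.Irrationality.Zudilin2003.uT n`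
is the solution of the SECOND Apéry-like recursion (13) of W. Zudilin, *A few remarks on linear forms involving Catalan's constant*,
arXiv:math/0210423 (Chebyshevskiĭ Sb. 3:2(4) (2002) 60–70), Theorem 2, with `ũ₀ = 0, ũ₁ = 6` (tree file
`Literature/NumberTheory/Irrationality/Zudilin2003/CatalanRemarks.lean`: `pT`, `qT`, `IsSolutionT`, `uT`; the assertions of Theorem 2 are
the UNPROVED named fact `Zudilin2003.remarksTheorem2` there).  Nothing in this file is a statement about Catalan's constant: these are
identities between explicitly defined rational numbers.

THEOREMS (all `m`, resp. `n ≥ 1`):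
* `uT_eq_utSum`, `utSum_eq_f32`, `uT_succ_eq_f32` : `ũ_{m+1} = T(m) = 4 (½)_m (½)_{m+1}/(m!)² · ₃F₂(−m−1, −m−1, m+½; ½, ½; 1)`, a
  terminating, termwise-positive hypergeometric sum (`utSum`); hence `uT_pos : ũ_n > 0`.
* `catalanQ_offDiagonal` : `(m+1)·catalanQ(m, m+1, m+1, m, m+2) = 2(−1)^m T(m)` and
  `uT_eq_box` : `ũ_n = (−1)^{n−1} (n/2) · catalanQ(n−1, n, n, n−1, n+1)` — Zudilin's second sequence is, up to the elementary factor
  `(−1)^{n−1} n/2`, the value of the cell's explicit box evaluator `CatalanQSum.catalanQ` at the OFF-DIAGONAL point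
  `(h,j,k,l,m) = (n−1,n,n,n−1,n+1)` (`S = j+k−m = n−1`, `C = k+l−h = n`).  (In the paper `ũ_n` is defined through the very-well-poised series
  (12); the point `(n−1,n,n,n−1,n+1)` was found numerically by the seat and is PROVED here — an identity between two explicitly defined
  rational sequences, saying nothing about the integrals `J(h,j,k,l,m)` themselves, whose evaluation `CatalanQSum.CoefficientLaw` stays open.)
The arithmetic consequences — `v₂(ũ_n) = 5 − 4n + 2s₂(n−1)`, `den ũ_n = 2^{4n−5−2s₂(n−1)}`, and the `u`-half `2^{4n} ũ_n ∈ ℤ` of the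
inclusions (14) of Theorem 2 with `o(n) ≡ 0` — are drawn in the sequel `CatalanRemarksUTDenominator`.

PROOF (creative telescoping; the certificate was found by the seat by linear algebra over `ℚ` and is checked here by `ring` /
`linear_combination`; no `native_decide`, `decide` only on the two closed rationals `T(0) = 6`, `T(1) = 115/2`).  With
`E(m,i) = B(m,i)·((m+3−i)(m+2−i)(m+1))²`, `B(m,i) = 4 C(m+3,i)² (½)_{m+1} (½)_{m+i} i! / ((m+3)!² ((½)_i)²)` (`utBase`, `utTerm`), the sum
`T(m) = Σ_{i ≤ m+1} E(m,i)` satisfies `c₊(m+2) T(m+2) − q̃(m+2) T(m+1) − c₋(m+2) T(m) = Σ_{i ≤ m+3} (G(m,i+1) − G(m,i)) = 0` with the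
certificate `G(m,i) = B(m,i)·(m+2)² P₇(m,i)·i·(i−½)²` (`utCert`; `P₇ = utCertPoly₇`, an explicit integer polynomial of degree 7) and
`c₊(n) = (2n)²(2n+1)² p̃(n)`, `c₋(n) = (2n)²(2n+1)(2n−3) p̃(n+1)` the extreme coefficients of (13): termwise (`utTelescope`) the three shifted
summands and the two certificate values are `B(m,i) ×` explicit polynomials (`utBase_succ_left`, `utBase_succ_right`), and what is left is
ONE polynomial identity (`utKey`, by `ring`).  With `T(0) = ũ₁`, `T(1) = ũ₂` and (13) at `n = 1` (where `ũ₀ = 0`), uniqueness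
(`Zudilin2003.IsSolutionT.ext_of_init`) gives `ũ_{m+1} = T(m)`; matching the term ratio of the tree's evaluator `f32Aux` identifies `T(m)`
with the box value.
-/

open Finset

namespace Summit.KontsevichZagierPeriods.Zeta5Search.CatalanRemarksUT

open Literature.NumberTheory.Irrationality
open Literature.NumberTheory.Irrationality.Zudilin2003 (pT qT IsSolutionT uT solT_isSolutionT)
open Summit.KontsevichZagierPeriods.Zeta5Search.CatalanQSum
open Summit.KontsevichZagierPeriods.Zeta5Search.CatalanQSumDiagonal (f32_diag_eq_sum)
open Summit.KontsevichZagierPeriods.Zeta5Search.SymmetricRecursion (choose_succ_left_cast choose_succ_right_cast)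

/-! ### The summand -/

/-- The common factor `B(m,i) = 4 C(m+3,i)² (½)_{m+1} (½)_{m+i} i! / ((m+3)!² ((½)_i)²)` of the three shifted summands and of the certificate. -/
def utBase (m i : ℕ) : ℚ :=
  4 * (((m + 3).choose i : ℕ) : ℚ) ^ 2 * poch (1 / 2) (m + 1) * poch (1 / 2) (m + i) * ((i.factorial : ℕ) : ℚ)
    / ((((m + 3).factorial : ℕ) : ℚ) ^ 2 * poch (1 / 2) i ^ 2)

/-- The summand `E(m,i) = B(m,i)·((m+3−i)(m+2−i)(m+1))²` `( = 4 (½)_{m+1} (½)_{m+i} i! C(m+1,i)² / ((m!)² ((½)_i)²) )`. -/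
def utTerm (m i : ℕ) : ℚ := utBase m i * (((m : ℚ) + 3 - i) * ((m : ℚ) + 2 - i) * ((m : ℚ) + 1)) ^ 2

/-- The sum `T(m) = Σ_{i ≤ m+1} E(m,i)` `( = 4 (½)_m (½)_{m+1}/(m!)² · ₃F₂(−m−1,−m−1,m+½;½,½;1) = ũ_{m+1} )`. -/
def utSum (m : ℕ) : ℚ := ∑ i ∈ range (m + 2), utTerm m i

/-- The candidate sequence `0, T(0), T(1), …` for `ũ`. -/
def utSeq : ℕ → ℚ
  | 0 => 0
  | m + 1 => utSum m

/-- `T(0) = 6 = ũ₁`. -/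
theorem utSum_zero : utSum 0 = 6 := by
  decide +kernel

/-- `T(1) = 115/2 = ũ₂`. -/
theorem utSum_one : utSum 1 = 115 / 2 := by
  decide +kernel

/-! ### Ratio identities of `B(m,i)` -/

/-- Shift in `m`: `B(m+1,i)·(m+4−i)² = B(m,i)·(m+3/2)(m+i+½)`. -/
theorem utBase_succ_left (m i : ℕ) :
    utBase (m + 1) i * ((m : ℚ) + 4 - i) ^ 2 = utBase m i * (((m : ℚ) + 3 / 2) * ((m : ℚ) + i + 1 / 2)) := by
  rcases lt_trichotomy i (m + 4) with hi | rfl | hi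
  · have h := choose_succ_left_cast (m + 3) i
    push_cast at h
    have hlt : (i : ℚ) < (m : ℚ) + 4 := by exact_mod_cast hi
    have hne : ((m : ℚ) + 3 + 1 - i) ≠ 0 := by intro h0; linarith
    have ha : (((m + 3 + 1).choose i : ℕ) : ℚ)
        = (((m + 3).choose i : ℕ) : ℚ) * ((m : ℚ) + 3 + 1) / ((m : ℚ) + 3 + 1 - i) := by
      rw [eq_div_iff hne]; exact h
    have hP : poch (1 / 2) i ≠ 0 := poch_oneHalf_ne_zero i
    have hE : (((m + 3).factorial : ℕ) : ℚ) ≠ 0 := by positivity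
    have h3 : ((m : ℚ) + 3 + 1) ≠ 0 := by positivity
    unfold utBase
    rw [show m + 1 + 3 = m + 3 + 1 from rfl, show m + 1 + i = m + i + 1 by omega, show m + 1 + 1 = m + 1 + 1 from rfl,
      Nat.factorial_succ (m + 3), ha]
    simp only [poch]
    push_cast
    field_simp
    ring
  · simp [utBase]
  · have h0 : (m + 3).choose i = 0 := Nat.choose_eq_zero_of_lt (by omega)
    have h1 : (m + 1 + 3).choose i = 0 := Nat.choose_eq_zero_of_lt (by omega)
    simp [utBase, h0, h1]

/-- Shift in `i`: `B(m,i+1)·(i+1)(i+½)² = B(m,i)·(m+3−i)²(m+i+½)`. -/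
theorem utBase_succ_right (m i : ℕ) :
    utBase m (i + 1) * (((i : ℚ) + 1) * ((i : ℚ) + 1 / 2) ^ 2)
      = utBase m i * (((m : ℚ) + 3 - i) ^ 2 * ((m : ℚ) + i + 1 / 2)) := by
  have h := choose_succ_right_cast (m + 3) i
  push_cast at h
  have hi1 : ((i : ℚ) + 1) ≠ 0 := by positivity
  have ha : (((m + 3).choose (i + 1) : ℕ) : ℚ) = (((m + 3).choose i : ℕ) : ℚ) * ((m : ℚ) + 3 - i) / ((i : ℚ) + 1) := by
    rw [eq_div_iff hi1]; exact h
  have hP : poch (1 / 2) i ≠ 0 := poch_oneHalf_ne_zero i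
  have hP1 : (1 / 2 + (i : ℚ)) ≠ 0 := by positivity
  have hE : (((m + 3).factorial : ℕ) : ℚ) ≠ 0 := by positivity
  unfold utBase
  rw [show m + (i + 1) = m + i + 1 from rfl, Nat.factorial_succ i, ha]
  simp only [poch]
  push_cast
  field_simp
  ring

/-- Shift in `i` for the summand: `E(m,i+1)·(i+1)(i+½)² = E(m,i)·(m+i+½)(m+1−i)²` — the term ratio of `₃F₂(−m−1,−m−1,m+½;½,½;1)`. -/
theorem utTerm_succ_right (m i : ℕ) :
    utTerm m (i + 1) * (((i : ℚ) + 1) * ((i : ℚ) + 1 / 2) ^ 2)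
      = utTerm m i * (((m : ℚ) + i + 1 / 2) * ((m : ℚ) + 1 - i) ^ 2) := by
  have h := utBase_succ_right m i
  unfold utTerm
  push_cast
  linear_combination ((((m : ℚ) + 3 - (i + 1)) * ((m : ℚ) + 2 - (i + 1)) * ((m : ℚ) + 1)) ^ 2) * h

/-! ### Positivity -/

/-- `(½)_n > 0` (lane edit lead/lit g13: `private` — textual twin of the tree's
`CatalanBeukersDenominator.poch_oneHalf_pos`, gate `dedup.landed`; pre-authorised by fam-catalan g7). -/
private theorem poch_oneHalf_pos' (n : ℕ) : 0 < poch (1 / 2) n := by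
  induction n with
  | zero => simp [poch]
  | succ n ih => rw [poch]; positivity

/-- `B(m,i) ≥ 0`. -/
theorem utBase_nonneg (m i : ℕ) : 0 ≤ utBase m i := by
  have h1 := poch_oneHalf_pos' (m + 1)
  have h2 := poch_oneHalf_pos' (m + i)
  have h3 := poch_oneHalf_pos' i
  unfold utBase
  positivity

/-- `E(m,i) ≥ 0`. -/
theorem utTerm_nonneg (m i : ℕ) : 0 ≤ utTerm m i := by
  have h := utBase_nonneg m i
  unfold utTerm
  positivity

/-- `E(m,0) = 4 (½)_m (½)_{m+1}/(m!)² > 0`. -/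
theorem utTerm_zero_pos (m : ℕ) : 0 < utTerm m 0 := by
  have h1 := poch_oneHalf_pos' (m + 1)
  have h2 := poch_oneHalf_pos' m
  have h0 : poch (1 / 2 : ℚ) 0 = 1 := by simp [poch]
  unfold utTerm utBase
  simp only [Nat.choose_zero_right, Nat.factorial_zero, Nat.cast_one, Nat.cast_zero, sub_zero, add_zero, h0]
  positivity

/-- `T(m) > 0`. -/
theorem utSum_pos (m : ℕ) : 0 < utSum m := by
  unfold utSum
  exact Finset.sum_pos' (fun i _ => utTerm_nonneg m i) ⟨0, by simp, utTerm_zero_pos m⟩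

/-! ### Creative telescoping: `T` solves Zudilin's second recursion (13) -/

/-- Leading coefficient `c₊(m+2) = (2m+4)²(2m+5)² p̃(m+2)` of (13) at index `n = m+2`. -/
def utRecHi (m : ℚ) : ℚ := (2 * m + 4) ^ 2 * (2 * m + 5) ^ 2 * (20 * m ^ 2 + 60 * m + 43)

/-- Middle coefficient `q̃(m+2)`. -/
def utRecMid (m : ℚ) : ℚ := 3520 * (m + 2) ^ 6 - 2672 * (m + 2) ^ 4 + 196 * (m + 2) ^ 2 - 9

/-- Trailing coefficient `c₋(m+2) = (2m+4)²(2m+5)(2m+1) p̃(m+3)`. -/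
def utRecLo (m : ℚ) : ℚ := (2 * m + 4) ^ 2 * (2 * m + 5) * (2 * m + 1) * (20 * m ^ 2 + 100 * m + 123)

/-- The certificate polynomial `P₇(m,i)` (found by linear algebra over `ℚ`; degree 7 in `m`, 2 in `i`). -/
def utCertPoly₇ (n i : ℚ) : ℚ :=
  -3520 * n ^ 7 + 1920 * n ^ 6 * i - 49440 * n ^ 6 + 320 * n ^ 5 * i ^ 2 + 21440 * n ^ 5 * i - 293488 * n ^ 5
    + 2400 * n ^ 4 * i ^ 2 + 99248 * n ^ 4 * i - 954648 * n ^ 4 + 6608 * n ^ 3 * i ^ 2 + 243664 * n ^ 3 * i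
    - 1837432 * n ^ 3 + 8280 * n ^ 2 * i ^ 2 + 333376 * n ^ 2 * i - 2091444 * n ^ 2 + 4736 * n * i ^ 2
    + 239568 * n * i - 1302174 * n + 984 * i ^ 2 + 70335 * i - 341766

/-- The full certificate polynomial `P(m,i) = (m+2)² P₇(m,i)`. -/
def utCertPoly (n i : ℚ) : ℚ := (n + 2) ^ 2 * utCertPoly₇ n i

/-- The telescoping certificate `G(m,i) = B(m,i)·P(m,i)·i·(i−½)²`. -/
def utCert (m i : ℕ) : ℚ := utBase m i * utCertPoly m i * (i : ℚ) * ((i : ℚ) - 1 / 2) ^ 2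

/-- The polynomial identity behind the certificate (everything divided by `B(m,i)`). -/
theorem utKey (n i : ℚ) :
    utRecHi n * ((n + 3) ^ 2 * (n + 5 / 2) * (n + i + 3 / 2) * ((n + 3 / 2) * (n + i + 1 / 2)))
      - utRecMid n * ((n + 3 / 2) * (n + i + 1 / 2) * ((n + 3 - i) * (n + 2)) ^ 2)
      - utRecLo n * ((n + 3 - i) * (n + 2 - i) * (n + 1)) ^ 2
      - (utCertPoly n (i + 1) * ((n + 3 - i) ^ 2 * (n + i + 1 / 2)) - utCertPoly n i * i * (i - 1 / 2) ^ 2) = 0 := by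
  unfold utRecHi utRecMid utRecLo utCertPoly utCertPoly₇
  ring

/-- **Termwise telescoping**: `c₊ E(m+2,i) − q̃ E(m+1,i) − c₋ E(m,i) = G(m,i+1) − G(m,i)` for all `m, i`. -/
theorem utTelescope (m i : ℕ) :
    utRecHi m * utTerm (m + 2) i - utRecMid m * utTerm (m + 1) i - utRecLo m * utTerm m i
      = utCert m (i + 1) - utCert m i := by
  have h1 := utBase_succ_left m i
  have h2 := utBase_succ_left (m + 1) i
  have h3 := utBase_succ_right m i
  have hK := utKey (m : ℚ) (i : ℚ)
  rw [show m + 1 + 1 = m + 2 from rfl] at h2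
  unfold utTerm utCert
  push_cast at h1 h2 h3 ⊢
  linear_combination (utRecHi (m : ℚ) * (((m : ℚ) + 4 - i) * ((m : ℚ) + 3)) ^ 2) * h2
    + (utRecHi (m : ℚ) * ((m : ℚ) + 3) ^ 2 * ((m : ℚ) + 5 / 2) * ((m : ℚ) + i + 3 / 2)
        - utRecMid (m : ℚ) * (((m : ℚ) + 3 - i) * ((m : ℚ) + 2)) ^ 2) * h1
    + (-(utCertPoly (m : ℚ) ((i : ℚ) + 1))) * h3 + (utBase m i) * hK

/-- `G(m,0) = 0`. -/
theorem utCert_zero (m : ℕ) : utCert m 0 = 0 := by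
  simp [utCert]

/-- `G(m,m+4) = 0` (the binomial vanishes). -/
theorem utCert_top (m : ℕ) : utCert m (m + 4) = 0 := by
  simp [utCert, utBase]

/-- `E(m,m+2) = 0`. -/
theorem utTerm_top₂ (m : ℕ) : utTerm m (m + 2) = 0 := by
  unfold utTerm; push_cast; ring

/-- `E(m,m+3) = 0`. -/
theorem utTerm_top₃ (m : ℕ) : utTerm m (m + 3) = 0 := by
  unfold utTerm; push_cast; ring

/-- `T(m)` as a sum over `i ≤ m+3` (two vanishing terms appended). -/
theorem utSum_eq_sum₄ (m : ℕ) : utSum m = ∑ i ∈ range (m + 4), utTerm m i := by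
  rw [utSum, Finset.sum_range_succ _ (m + 3), Finset.sum_range_succ _ (m + 2), utTerm_top₂, utTerm_top₃, add_zero, add_zero]

/-- `T(m+1)` as a sum over `i ≤ m+3` (one vanishing term appended). -/
theorem utSum_succ_eq_sum₄ (m : ℕ) : utSum (m + 1) = ∑ i ∈ range (m + 4), utTerm (m + 1) i := by
  have h : utTerm (m + 1) (m + 3) = 0 := by unfold utTerm; push_cast; ring
  rw [utSum, Finset.sum_range_succ _ (m + 3), h, add_zero]

/-- `T(m+2)` is a sum over `i ≤ m+3` by definition. -/
theorem utSum_succ_succ_eq_sum₄ (m : ℕ) : utSum (m + 2) = ∑ i ∈ range (m + 4), utTerm (m + 2) i := rfl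

/-- **The recursion**: `c₊(m+2) T(m+2) − q̃(m+2) T(m+1) − c₋(m+2) T(m) = 0` for all `m`. -/
theorem utSum_rec (m : ℕ) : utRecHi m * utSum (m + 2) - utRecMid m * utSum (m + 1) - utRecLo m * utSum m = 0 := by
  have hsum : utRecHi m * utSum (m + 2) - utRecMid m * utSum (m + 1) - utRecLo m * utSum m
      = ∑ i ∈ range (m + 4), (utCert m (i + 1) - utCert m i) := by
    rw [utSum_succ_succ_eq_sum₄, utSum_succ_eq_sum₄, utSum_eq_sum₄, Finset.mul_sum, Finset.mul_sum,
      Finset.mul_sum, ← Finset.sum_sub_distrib, ← Finset.sum_sub_distrib]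
    exact Finset.sum_congr rfl fun i _ => utTelescope m i
  rw [hsum, Finset.sum_range_sub, utCert_top, utCert_zero, sub_zero]

/-- **`0, T(0), T(1), …` solves Zudilin's second difference equation (13)** (at `n = 1` by the two initial values, `ũ₀ = 0`). -/
theorem utSeq_isSolutionT : IsSolutionT utSeq := by
  intro n hn
  rcases Nat.lt_or_ge n 2 with h2 | h2
  · obtain rfl : n = 1 := by omega
    show (2 * ((1 : ℕ) : ℚ)) ^ 2 * (2 * ((1 : ℕ) : ℚ) + 1) ^ 2 * pT ((1 : ℕ) : ℚ) * utSum 1 - qT ((1 : ℕ) : ℚ) * utSum 0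
        - (2 * ((1 : ℕ) : ℚ)) ^ 2 * (2 * ((1 : ℕ) : ℚ) + 1) * (2 * ((1 : ℕ) : ℚ) - 3) * pT (((1 : ℕ) : ℚ) + 1) * 0 = 0
    rw [utSum_zero, utSum_one]
    norm_num [pT, qT]
  · obtain ⟨m, rfl⟩ : ∃ m, n = m + 2 := ⟨n - 2, by omega⟩
    have h := utSum_rec m
    unfold utRecHi utRecMid utRecLo at h
    show (2 * ((m + 2 : ℕ) : ℚ)) ^ 2 * (2 * ((m + 2 : ℕ) : ℚ) + 1) ^ 2 * pT ((m + 2 : ℕ) : ℚ) * utSum (m + 2)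
        - qT ((m + 2 : ℕ) : ℚ) * utSum (m + 1)
        - (2 * ((m + 2 : ℕ) : ℚ)) ^ 2 * (2 * ((m + 2 : ℕ) : ℚ) + 1) * (2 * ((m + 2 : ℕ) : ℚ) - 3) * pT (((m + 2 : ℕ) : ℚ) + 1)
          * utSeq (m + 2 - 1) = 0
    rw [show m + 2 - 1 = m + 1 by omega]
    show _ - _ - _ * utSum m = 0
    unfold pT qT
    push_cast
    linear_combination h

/-- **`ũ = (0, T(0), T(1), …)`**: same recursion (13), same initial data `ũ₀ = 0`, `ũ₁ = 6`. -/
theorem utSeq_eq_uT : utSeq = uT :=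
  utSeq_isSolutionT.ext_of_init (solT_isSolutionT 0 6) rfl (by show utSum 0 = 6; exact utSum_zero)

/-- `ũ_{m+1} = T(m) = Σ_{i ≤ m+1} E(m,i)`. -/
theorem uT_eq_utSum (m : ℕ) : uT (m + 1) = utSum m := by
  rw [← utSeq_eq_uT]; rfl

/-- **`ũ_n > 0` for `n ≥ 1`.** -/
theorem uT_pos {n : ℕ} (hn : 1 ≤ n) : 0 < uT n := by
  obtain ⟨m, rfl⟩ : ∃ m, n = m + 1 := ⟨n - 1, by omega⟩
  rw [uT_eq_utSum]; exact utSum_pos m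

/-! ### `T(m)` is the box value of the tree's evaluator at `(m, m+1, m+1, m, m+2)` -/

/-- The `i`-th term of the evaluator of `₃F₂(−m−1,−m−1,m+½;½,½;1)`, times `4(½)_m(½)_{m+1}/(m!)²`, is `E(m,i)`. -/
theorem f32Aux_fst_eq_utTerm (m : ℕ) :
    ∀ i, 4 * poch (1 / 2) m * poch (1 / 2) (m + 1) / ((m.factorial : ℕ) : ℚ) ^ 2
        * (f32Aux (m + 1) (m + 1) ((m : ℚ) + 1 / 2) (1 / 2) (1 / 2) i).1 = utTerm m i := by
  intro i
  induction i with
  | zero =>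
    have hf : (((m + 3).factorial : ℕ) : ℚ) = ((m : ℚ) + 3) * ((m : ℚ) + 2) * ((m : ℚ) + 1) * ((m.factorial : ℕ) : ℚ) := by
      rw [Nat.factorial_succ, Nat.factorial_succ, Nat.factorial_succ]; push_cast; ring
    have hn : ((m.factorial : ℕ) : ℚ) ≠ 0 := by positivity
    have h1 : ((m : ℚ) + 1) ≠ 0 := by positivity
    have h2 : ((m : ℚ) + 2) ≠ 0 := by positivity
    have h3 : ((m : ℚ) + 3) ≠ 0 := by positivity
    simp only [f32Aux, utTerm, utBase, poch, Nat.choose_zero_right, Nat.factorial_zero, Nat.cast_one, Nat.cast_zero,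
      add_zero, sub_zero, one_pow, mul_one]
    rw [hf]
    field_simp
  | succ i ih =>
    have hR := utTerm_succ_right m i
    have hB : ((i : ℚ) + 1) * (1 / 2 + (i : ℚ)) * (1 / 2 + (i : ℚ)) ≠ 0 := by positivity
    rw [f32Aux_fst_succ, ← mul_assoc, ih, mul_div_assoc', eq_comm, eq_div_iff hB]
    push_cast
    linear_combination hR

/-- `T(m) = 4 (½)_m (½)_{m+1}/(m!)² · ₃F₂(−m−1, −m−1, m+½; ½, ½; 1)`. -/
theorem utSum_eq_f32 (m : ℕ) :
    utSum m = 4 * poch (1 / 2) m * poch (1 / 2) (m + 1) / ((m.factorial : ℕ) : ℚ) ^ 2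
      * f32 (m + 1) (m + 1) ((m : ℚ) + 1 / 2) (1 / 2) (1 / 2) := by
  unfold utSum
  rw [f32_diag_eq_sum, Finset.mul_sum]
  exact Finset.sum_congr rfl fun i _ => (f32Aux_fst_eq_utTerm m i).symm

/-- **The box value at `(m, m+1, m+1, m, m+2)`**: `(m+1)·catalanQ(m, m+1, m+1, m, m+2) = 2(−1)^m T(m)`. -/
theorem catalanQ_offDiagonal (m : ℕ) :
    ((m : ℚ) + 1) * catalanQ m (m + 1) (m + 1) m (m + 2) = 2 * (-1) ^ m * utSum m := by
  have hS : m + 1 + (m + 1) - (m + 2) = m := by omega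
  have hC : m + 1 + m - m = m + 1 := by omega
  have hg : gammaHalfRatio 0 = 1 := by simp [gammaHalfRatio, poch]
  have hsign : ((-1 : ℚ)) ^ (m + m + m) = (-1) ^ m := by
    rw [show m + m + m = 2 * m + m by ring, pow_add, pow_mul]; norm_num
  have hf : (((m + 1).factorial : ℕ) : ℚ) = ((m : ℚ) + 1) * ((m.factorial : ℕ) : ℚ) := by
    rw [Nat.factorial_succ]; push_cast; ring
  have hn : ((m.factorial : ℕ) : ℚ) ≠ 0 := by positivity
  have h1 : ((m : ℚ) + 1) ≠ 0 := by positivity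
  rw [utSum_eq_f32]
  change ((m : ℚ) + 1) * (8 * (-1) ^ (m + m + (m + 1 + (m + 1) - (m + 2))) * poch (1 / 2) m * poch (1 / 2) (m + 1)
      * gammaHalfRatio ((m : ℤ) - m) * gammaHalfRatio ((m : ℤ) - ((m + 1 + (m + 1) - (m + 2) : ℕ) : ℤ))
      / ((((m + 1 + (m + 1) - (m + 2)).factorial : ℕ) : ℚ) * (((m + 1 + m - m).factorial : ℕ) : ℚ))
      * f32 (m + 1) (m + 1 + m - m) ((m : ℚ) + 1 / 2) ((m : ℚ) - m + 1 / 2)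
          ((m : ℚ) - ((m + 1 + (m + 1) - (m + 2) : ℕ) : ℚ) + 1 / 2)) = _
  rw [hS, hC]
  simp only [sub_self, zero_add, hg, hsign, mul_one, hf]
  field_simp
  ring

/-- **`ũ_n` is the box value**: `ũ_n = (−1)^{n−1} (n/2) · catalanQ(n−1, n, n, n−1, n+1)` for `n ≥ 1` — Zudilin's second sequence
(arXiv:math/0210423, Theorem 2, defined there through the series (12)) equals, up to the factor `(−1)^{n−1} n/2`, the cell's explicit box
evaluator `CatalanQSum.catalanQ` at the off-diagonal point `(n−1,n,n,n−1,n+1)`. -/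
theorem uT_eq_box {n : ℕ} (hn : 1 ≤ n) :
    uT n = (-1) ^ (n - 1) * ((n : ℚ) / 2) * catalanQ (n - 1) n n (n - 1) (n + 1) := by
  obtain ⟨m, rfl⟩ : ∃ m, n = m + 1 := ⟨n - 1, by omega⟩
  have h := catalanQ_offDiagonal m
  have h1 : ((-1 : ℚ) ^ m) ^ 2 = 1 := by rw [← pow_mul, mul_comm, pow_mul, neg_one_sq, one_pow]
  rw [show m + 1 - 1 = m from rfl, show m + 1 + 1 = m + 2 from rfl, uT_eq_utSum]
  push_cast
  linear_combination (-((-1 : ℚ) ^ m) / 2) * h + (-(utSum m)) * h1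

/-- Zudilin's `ũ_n` as an explicit terminating `₃F₂(1)`:
`ũ_{m+1} = 4 (½)_m (½)_{m+1}/(m!)² · ₃F₂(−m−1, −m−1, m+½; ½, ½; 1)`. -/
theorem uT_succ_eq_f32 (m : ℕ) :
    uT (m + 1) = 4 * poch (1 / 2) m * poch (1 / 2) (m + 1) / ((m.factorial : ℕ) : ℚ) ^ 2
      * f32 (m + 1) (m + 1) ((m : ℚ) + 1 / 2) (1 / 2) (1 / 2) := by
  rw [uT_eq_utSum, utSum_eq_f32]

end Summit.KontsevichZagierPeriods.Zeta5Search.CatalanRemarksUT
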